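import Summits.QuantumFields.YangMills.Theorems.InfiniteVolumePerOrderStateIVData
import Summits.QuantumFields.YangMills.Theorems.BalabanLadderInfVolPlaneDictionary
import HarnessLib

/-!
# AtomicCalibrationR (stmt-QuantumFields-28169), B7 `stub_smearedIVData` — first brick: the SMEARED compactness step
# (planner ym-idea-11 g15's `STUB-PLAN-smearedIVData.md`, steps 1–4; prover w4 g23, free hands)

The smeared infinite-volume engine replaces the pointwise collar bound of the landed per-order engines
(`InfiniteVolume.PerOrderSlack.exists_subseq_limit_of_zdCollar`, `PerOrderState.ivData_perOrderState`: collar ⟹ `a`-uniform bound on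
`⁰𝒮`) by the smeared bound ITSELF, as a hypothesis on the submodule `⁰𝒮` of off-diagonal test functions.  This file is the
floor-shape-agnostic functional-analytic part:

* `exists_subseq_limit_of_smeared` — ABSTRACT FORM: weights `W k n q x` with `|W| ≤ Mⁿ`, evaluation points `y k n q x` within `6a_k` of
  `a_k·x`, and the smeared bound `‖Σ'ₓ W_k F(y_k x)‖ ≤ c n · ‖F‖_{m n}` on `⁰𝒮` (`n ≥ 2`, increasing orientations) give a
  subsequence `φ` and limits `S n q` with `‖S n q F‖ ≤ c n ‖F‖_{m n}` for ALL `F` (Hahn–Banach inside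
  `OSLegsFromFemtoAndGap.exists_subseq_clm_limit`) and convergence on `⁰𝒮`;
* `smearedData` — for states `μ ∈ oddTorusLimitPoints r β` (`β ≥ β₈`, one common odd-torus sequence,
  `InfiniteVolume.exists_strictMono_forall_mem_oddTorusLimitPoints`) and the plane-string weights `stateMomentStr` at the plaquette
  centres: couplings `β_k → ∞`, states `μ_k`, the one-field family `S₁` (`S₁ 0 = eval`, `S₁ 1 = 0`, `S₁ n = Σ_q T n q`) and the limits
  `T n q` with the leaf's DATA convergence clause verbatim, the bounds `‖T n q F‖ ≤ c n ‖F‖_{Nn}` and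
  `‖S₁ n F‖ ≤ 6ⁿ · max 1 (c n) · ‖F‖_{Nn}` for all `F`.

What B7 still needs on top (not here): E0′ in OS form, reflection positivity, hermiticity, hyperoctahedral invariance, symmetry,
translations, NT/NG — the template's remaining sections.  HONEST FRAMING: soft analysis; the smeared bound is a HYPOTHESIS; nothing
about Bałaban's RG, a mass gap or Clay; no summit is proved. [folklore]
References: Glimm–Jaffe (1987) §6.1; Osterwalder–Schrader CMP 42 (1975) §2; Chatterjee arXiv:1803.01950 §2.
-/

set_option autoImplicit false

noncomputable section

open scoped BigOperators SchwartzMap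
open MeasureTheory Filter Topology
open Literature.MathematicalPhysics.QuantumFieldTheory hiding ZdEdge
open Literature.MathematicalPhysics.QuantumLattice
open Literature.MathematicalPhysics.AQFT
open Literature.Probability.LatticeModels (box Site)
open Summit.QuantumFields.YangMills.Cruxes.OSLegsFromFemtoAndGap.DlrCollarTransfer (plane exists_abs_plane_le)
open Summit.QuantumFields.YangMills.Theorems.OSLegsFromFemtoAndGap (exists_subseq_clm_limit)
open Summit.QuantumFields.YangMills.Theorems.InfiniteVolume (stateMomentStr exists_clm_eq_tsum abs_stateMomentStr_le
  exists_strictMono_forall_mem_oddTorusLimitPoints norm_centreOffset_le card_validStrings)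

namespace Summit.QuantumFields.YangMills.Cruxes.AtomicCalibrationR.SmearedCompactness

/-! ## §1 The compactness step with a SMEARED bound, abstract weights -/

/-- **THE SMEARED COMPACTNESS STEP, ABSTRACT FORM.**  See the module docstring. [folklore] -/
theorem exists_subseq_limit_of_smeared {M : ℝ} (hM : 0 ≤ M) (a : ℕ → ℝ) (ha : ∀ k, 0 < a k) (ha24 : ∀ k, a k ≤ 1 / 24)
    (W : ℕ → (n : ℕ) → (Fin n → Fin 4 × Fin 4) → (Fin n → Site 4) → ℝ) (hWsup : ∀ k n q x, |W k n q x| ≤ M ^ n)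
    (y : ℕ → (n : ℕ) → (Fin n → Fin 4 × Fin 4) → (Fin n → Site 4) → (Fin n → EuclideanSpace ℝ (Fin 4)))
    (hy : ∀ k n q x l, ‖y k n q x l - a k • siteToE (x l)‖ ≤ 6 * a k) (c : ℕ → ℝ) (m : ℕ → ℕ) (hc : ∀ n, 0 ≤ c n)
    (hbd : ∀ (k n : ℕ) (q : Fin n → Fin 4 × Fin 4), 2 ≤ n → (∀ i, (q i).1 < (q i).2) →
      ∀ F : 𝓢((Fin n → EuclideanSpace ℝ (Fin 4)), ℂ), IsOffDiagonal F →
        ‖∑' x : Fin n → Site 4, ((W k n q x : ℝ) : ℂ) * F (y k n q x)‖ ≤ c n * schwartzNorm (m n) F) :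
    ∃ φ : ℕ → ℕ, StrictMono φ ∧
      ∃ S : (n : ℕ) → (Fin n → Fin 4 × Fin 4) → (𝓢((Fin n → EuclideanSpace ℝ (Fin 4)), ℂ) →L[ℂ] ℂ),
        (∀ n q F, ‖S n q F‖ ≤ c n * schwartzNorm (m n) F) ∧
        ∀ n : ℕ, 2 ≤ n → ∀ q : Fin n → Fin 4 × Fin 4, (∀ i, (q i).1 < (q i).2) →
          ∀ F : 𝓢((Fin n → EuclideanSpace ℝ (Fin 4)), ℂ), IsOffDiagonal F →
            Tendsto (fun j => ∑' x : Fin n → Site 4, ((W (φ j) n q x : ℝ) : ℂ) * F (y (φ j) n q x)) atTop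
              (𝓝 (S n q F)) := by
  classical
  have ha1 : ∀ k, a k ≤ 1 := fun k => (ha24 k).trans (by norm_num)
  have hsa : ∀ k, 6 * a k ≤ 1 / 4 := fun k => by linarith [ha24 k]
  have hMn : ∀ n : ℕ, 0 ≤ M ^ n := fun n => pow_nonneg hM n
  -- the series functionals as continuous linear functionals
  have hT : ∀ (k n : ℕ) (q : Fin n → Fin 4 × Fin 4),
      ∃ T : 𝓢((Fin n → EuclideanSpace ℝ (Fin 4)), ℂ) →L[ℂ] ℂ,
        ∀ F, T F = ∑' x : Fin n → Site 4, ((W k n q x : ℝ) : ℂ) * F (y k n q x) := fun k n q =>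
    exists_clm_eq_tsum (ha k) (ha1 k) (hsa k) (hMn n) (W k n q) (hWsup k n q) (y k n q) (hy k n q)
  choose T hT using hT
  -- the joint index and the off-diagonal submodules
  let ι := Σ n : ℕ, (Fin n → Fin 4 × Fin 4)
  let Tι : (i : ι) → ℕ → (𝓢((Fin i.1 → EuclideanSpace ℝ (Fin 4)), ℂ) →L[ℂ] ℂ) := fun i k =>
    if 2 ≤ i.1 ∧ (∀ l, (i.2 l).1 < (i.2 l).2) then T k i.1 i.2 else 0
  let Mod : (i : ι) → Submodule ℂ 𝓢((Fin i.1 → EuclideanSpace ℝ (Fin 4)), ℂ) := fun i =>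
    { carrier := {F | IsOffDiagonal F}
      add_mem' := fun hF hG => hF.add hG
      zero_mem' := isOffDiagonal_zero
      smul_mem' := fun c _ hF => hF.smul c }
  have hMod : ∀ i (F : 𝓢((Fin i.1 → EuclideanSpace ℝ (Fin 4)), ℂ)), F ∈ Mod i ↔ IsOffDiagonal F :=
    fun i F => Iff.rfl
  -- the smeared bound on `⁰𝒮`, as given
  have hbound : ∀ i k, ∀ F ∈ Mod i, ‖Tι i k F‖ ≤ c i.1 * schwartzNorm (m i.1) F := by
    rintro ⟨n, q⟩ k F hF
    rw [hMod] at hF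
    by_cases hn : 2 ≤ n ∧ (∀ l, (q l).1 < (q l).2)
    · simp only [Tι, if_pos hn, hT]
      exact hbd k n q hn.1 hn.2 F hF
    · simp only [Tι, if_neg hn, zero_apply, norm_zero]
      exact mul_nonneg (hc _) (schwartzNorm_nonneg _ _)
  obtain ⟨φ, hφ, Slim, hSlim, hconv⟩ := exists_subseq_clm_limit
    (X := fun i : ι => Fin i.1 → EuclideanSpace ℝ (Fin 4)) Tι Mod (fun i => m i.1) (fun i => c i.1) (fun i => hc _) hbound
  refine ⟨φ, hφ, fun n q => Slim ⟨n, q⟩, fun n q F => hSlim ⟨n, q⟩ F, fun n hn q hq F hF => ?_⟩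
  have h := hconv ⟨n, q⟩ F ((hMod ⟨n, q⟩ F).2 hF)
  simp only [Tι, if_pos (And.intro hn hq), hT] at h
  exact h

/-! ## §2 The smeared DATA package for odd-torus limit states -/

variable {G : Type} [Group G] [TopologicalSpace G] [IsTopologicalGroup G] [CompactSpace G]
  [MeasurableSpace G] [BorelSpace G]

/-- **THE SMEARED DATA PACKAGE** (steps 1–4 of the B7 stub plan).  See the module docstring. [folklore] -/
theorem smearedData (r : LatticeRep G) (a : ℝ → ℝ) (hapos : ∀ β, 0 < a β) (ha0 : Tendsto a atTop (𝓝 0))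
    (c : ℕ → ℝ) (N : ℕ) (β₈ : ℝ) (hc : ∀ n, 0 ≤ c n)
    (hbd : ∀ β : ℝ, β₈ ≤ β → ∀ μ ∈ oddTorusLimitPoints r β, ∀ (n : ℕ) (q : Fin n → Fin 4 × Fin 4), 2 ≤ n →
      (∀ i, (q i).1 < (q i).2) → ∀ F : 𝓢((Fin n → EuclideanSpace ℝ (Fin 4)), ℂ), IsOffDiagonal F →
        ‖∑' x : Fin n → (Fin 4 → ℤ), ((stateMomentStr G r μ n q x : ℝ) : ℂ) *
            F (fun l => a β • siteToE (x l) +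
              (a β / 2) • (EuclideanSpace.single (q l).1 (1 : ℝ) + EuclideanSpace.single (q l).2 (1 : ℝ)))‖ ≤
          c n * schwartzNorm (N * n) F) :
    ∃ (β : ℕ → ℝ) (μ : ℕ → Measure (LGConfig 4 G)) (S₁ : SchwingerFamily (EuclideanSpace ℝ (Fin 4)))
      (T : (n : ℕ) → (Fin n → Fin 4 × Fin 4) → (𝓢((Fin n → EuclideanSpace ℝ (Fin 4)), ℂ) →L[ℂ] ℂ)),
      (Tendsto β atTop atTop ∧ (∀ k, μ k ∈ oddTorusLimitPoints r (β k)) ∧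
        (∀ F : 𝓢((Fin 0 → EuclideanSpace ℝ (Fin 4)), ℂ), S₁ 0 F = F default) ∧
        (∀ F : 𝓢((Fin 1 → EuclideanSpace ℝ (Fin 4)), ℂ), S₁ 1 F = 0) ∧
        (∀ n : ℕ, 2 ≤ n → ∀ F : 𝓢((Fin n → EuclideanSpace ℝ (Fin 4)), ℂ),
          S₁ n F = ∑ q ∈ Fintype.piFinset (fun _ : Fin n => Finset.univ.filter fun p : Fin 4 × Fin 4 => p.1 < p.2),
            T n q F) ∧
        (∀ n : ℕ, 2 ≤ n → ∀ q : Fin n → Fin 4 × Fin 4, (∀ i, (q i).1 < (q i).2) →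
          ∀ F : 𝓢((Fin n → EuclideanSpace ℝ (Fin 4)), ℂ), IsOffDiagonal F →
            Tendsto (fun k => ∑' x : Fin n → (Fin 4 → ℤ), ((stateMomentStr G r (μ k) n q x : ℝ) : ℂ) *
              F (fun l => a (β k) • siteToE (x l) +
                (a (β k) / 2) • (EuclideanSpace.single (q l).1 (1 : ℝ) + EuclideanSpace.single (q l).2 (1 : ℝ))))
              atTop (𝓝 (T n q F)))) ∧
      (∀ k, β₈ ≤ β k) ∧ (∀ k, IsProbabilityMeasure (μ k)) ∧ (∀ k, a (β k) ≤ 1 / 24) ∧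
      (∀ n : ℕ, ∀ q : Fin n → Fin 4 × Fin 4, ∀ F : 𝓢((Fin n → EuclideanSpace ℝ (Fin 4)), ℂ),
        ‖T n q F‖ ≤ c n * schwartzNorm (N * n) F) ∧
      (∀ (n : ℕ) (F : 𝓢((Fin n → EuclideanSpace ℝ (Fin 4)), ℂ)),
        ‖S₁ n F‖ ≤ 6 ^ n * max 1 (c n) * schwartzNorm (N * n) F) := by
  classical
  -- 1. couplings above every threshold, with `a` below `1/24`
  obtain ⟨B₁, hB₁⟩ : ∃ B₁ : ℝ, ∀ b, B₁ ≤ b → a b < 1 / 24 :=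
    Filter.eventually_atTop.1 (ha0.eventually (gt_mem_nhds (by norm_num)))
  set βs : ℕ → ℝ := fun k => max β₈ B₁ + (k : ℝ) with hβs
  have hβs8 : ∀ k, β₈ ≤ βs k := fun k => by
    simp only [hβs]; linarith [le_max_left β₈ B₁, (Nat.cast_nonneg k : (0 : ℝ) ≤ k)]
  have hβsB : ∀ k, B₁ ≤ βs k := fun k => by
    simp only [hβs]; linarith [le_max_right β₈ B₁, (Nat.cast_nonneg k : (0 : ℝ) ≤ k)]
  have hβs_top : Tendsto βs atTop atTop := tendsto_atTop_add_const_left atTop _ tendsto_natCast_atTop_atTop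
  have ha_pos : ∀ k, 0 < a (βs k) := fun k => hapos _
  have ha_24 : ∀ k, a (βs k) ≤ 1 / 24 := fun k => (hB₁ _ (hβsB k)).le
  -- 2. states along one common odd-torus sequence
  obtain ⟨Ssub, -, μ, hμ⟩ := exists_strictMono_forall_mem_oddTorusLimitPoints r βs
  haveI hprob : ∀ k, IsProbabilityMeasure (μ k) := fun k => (hμ k).1
  have hμmem : ∀ k, μ k ∈ oddTorusLimitPoints r (βs k) := fun k => (hμ k).2.1
  -- 3. the weights and the evaluation points (plaquette centres)
  obtain ⟨Cp, hCp⟩ := exists_abs_plane_le (G := G) r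
  have hCp0 : 0 ≤ Cp := le_trans (abs_nonneg _) (hCp (0, 1) 0 (fun _ => 1))
  have hWsup : ∀ (k n : ℕ) (q : Fin n → Fin 4 × Fin 4) (x : Fin n → Site 4),
      |stateMomentStr G r (μ k) n q x| ≤ (Cp + Cp) ^ n := fun k n q x => abs_stateMomentStr_le r (μ k) hCp q x
  have hy : ∀ (k n : ℕ) (q : Fin n → Fin 4 × Fin 4) (x : Fin n → Site 4) (l : Fin n),
      ‖(a (βs k) • siteToE (x l) +
          (a (βs k) / 2) • (EuclideanSpace.single (q l).1 (1 : ℝ) + EuclideanSpace.single (q l).2 (1 : ℝ))) -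
        a (βs k) • siteToE (x l)‖ ≤ 6 * a (βs k) := by
    intro k n q x l
    rw [add_sub_cancel_left]
    exact (norm_centreOffset_le (ha_pos k).le (q l)).trans (by linarith [ha_pos k])
  -- 4. the smeared compactness step
  obtain ⟨φ, hφ, T, hTb, hconv⟩ := exists_subseq_limit_of_smeared (by positivity : 0 ≤ Cp + Cp) (fun k => a (βs k))
    ha_pos ha_24 (fun k n q x => stateMomentStr G r (μ k) n q x) hWsup
    (fun k n q x l => a (βs k) • siteToE (x l) +
      (a (βs k) / 2) • (EuclideanSpace.single (q l).1 (1 : ℝ) + EuclideanSpace.single (q l).2 (1 : ℝ)))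
    hy c (fun n => N * n) hc (fun k n q hn hq F hF => hbd (βs k) (hβs8 k) (μ k) (hμmem k) n q hn hq F hF)
  -- 5. the one-field family
  let P : (n : ℕ) → Finset (Fin n → Fin 4 × Fin 4) := fun n =>
    Fintype.piFinset (fun _ : Fin n => Finset.univ.filter fun p : Fin 4 × Fin 4 => p.1 < p.2)
  let S₁ : SchwingerFamily (EuclideanSpace ℝ (Fin 4)) := fun n =>
    if n = 0 then LabelledSchwingerFamily.evalAt default else if n = 1 then 0 else ∑ q ∈ P n, T n q
  have hS₁0' : S₁ 0 = LabelledSchwingerFamily.evalAt default := rfl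
  have hS₁1' : S₁ 1 = 0 := rfl
  have hS₁0 : ∀ F : 𝓢((Fin 0 → EuclideanSpace ℝ (Fin 4)), ℂ), S₁ 0 F = F default := fun F => by
    rw [hS₁0', LabelledSchwingerFamily.evalAt_apply]
  have hS₁1 : ∀ F : 𝓢((Fin 1 → EuclideanSpace ℝ (Fin 4)), ℂ), S₁ 1 F = 0 := fun F => by
    rw [hS₁1']; rfl
  have hS₁2 : ∀ n : ℕ, 2 ≤ n → ∀ F : 𝓢((Fin n → EuclideanSpace ℝ (Fin 4)), ℂ),
      S₁ n F = ∑ q ∈ P n, T n q F := fun n hn F => by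
    have h : S₁ n = ∑ q ∈ P n, T n q := by
      simp only [S₁, if_neg (show n ≠ 0 by omega), if_neg (show n ≠ 1 by omega)]
    rw [h, FunLike.coe_sum, Finset.sum_apply]
  -- 6. assemble
  refine ⟨fun k => βs (φ k), fun k => μ (φ k), S₁, T,
    ⟨hβs_top.comp hφ.tendsto_atTop, fun k => hμmem (φ k), hS₁0, hS₁1, hS₁2, fun n hn q hq F hF => hconv n hn q hq F hF⟩,
    fun k => hβs8 (φ k), fun k => hprob (φ k), fun k => ha_24 (φ k), hTb, fun n F => ?_⟩
  -- the bound on `S₁ n`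
  have hSN : 0 ≤ schwartzNorm (N * n) F := schwartzNorm_nonneg _ _
  have hmax : 1 ≤ max 1 (c n) := le_max_left _ _
  rcases Nat.lt_or_ge n 2 with hn | hn
  · interval_cases n
    · rw [hS₁0]
      have h1 := norm_le_schwartzNorm (N * 0) F default
      calc ‖F default‖ ≤ schwartzNorm (N * 0) F := h1
        _ = 6 ^ 0 * 1 * schwartzNorm (N * 0) F := by ring
        _ ≤ 6 ^ 0 * max 1 (c 0) * schwartzNorm (N * 0) F := by gcongr
    · rw [hS₁1, norm_zero]; positivity
  · rw [hS₁2 n hn]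
    calc ‖∑ q ∈ P n, T n q F‖ ≤ ∑ q ∈ P n, ‖T n q F‖ := norm_sum_le _ _
      _ ≤ ∑ _q ∈ P n, c n * schwartzNorm (N * n) F := Finset.sum_le_sum fun q _ => hTb n q F
      _ = 6 ^ n * c n * schwartzNorm (N * n) F := by
          rw [Finset.sum_const, nsmul_eq_mul, card_validStrings]; ring
      _ ≤ 6 ^ n * max 1 (c n) * schwartzNorm (N * n) F := by gcongr; exact le_max_right _ _

end Summit.QuantumFields.YangMills.Cruxes.AtomicCalibrationR.SmearedCompactness

end
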